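import Literature.NumberTheory.IwasawaTheory.Fukuda1994Thm1RankPackage
import Literature.NumberTheory.IwasawaTheory.FukudaRankGrowthSteps
import Literature.NumberTheory.IwasawaTheory.Fukuda1994Thm1Consequences
import HarnessLib

/-!
# Fukuda 1994, Theorem 1 (2): PROOF of `fukuda1994_thm1_classGroupPRank_const_of_succ_eq` at finite level
# (rank constancy AND the rider `μ = 0`, from the package `Fukuda1994Thm1RankPackage` and the group-theoretic steps `FukudaRankGrowthSteps`)

Topic `NumberTheory/IwasawaTheory` (namespace = path). THEOREM-ONLY file (no definition, no named fact, no `sorry`), written by the prover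
seat `bsd-potss-k8t-c4` g20 (cell `bsd-potss`; Fukuda road of stmt-BirchSwinnertonDyer-19982; closes nothing). It discharges the named fact
`Literature.NumberTheory.IwasawaTheory.fukuda1994_thm1_classGroupPRank_const_of_succ_eq` (`ClassicalMuInvariant.lean` §5) by
`fukuda1994_thm1_classGroupPRank_const_of_succ_eq_holds`; the sibling Thm. 1 (1) is `Fukuda1994Thm1Proofs.lean` (g19).  Bricks: `FukudaGroupLayers`
(Washington 13.15/13.18 for all layers), `FukudaGrowthAlgebra` (module algebra of the `μ = 0` rider), `FukudaRankGrowthSteps` (rank step, growth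
step), `FukudaRankCountingLemmas` + `FukudaPElementaryInclusion` (class field theory for `p`-ranks), `Fukuda1994Thm1RankLayer` +
`Fukuda1994Thm1RankPackage` (the tower `K_n ⊆ K_{n+j} ⊆ K_{n+t} ⊆ H_p` packaged as an abstract finite group with per-layer index/rank data),
and g19's bricks (R), (C), (D).

STATEMENT PROVED: for a number field `K`, a prime `p`, a `ℤ_p`-extension `κ` of `K` with Fukuda index `n₀` (`TotallyRamifiedFrom κ n₀`) and
`n ≥ n₀` with `rank_p Cl(K_{n+1}) = rank_p Cl(K_n)`: (i) `rank_p Cl(K_m) = rank_p Cl(K_n)` for all `m ≥ n`; (ii) `ClassicalMuVanishes κ`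
(`e_m = ord_p h(K_m) = λ·m + ν` for `m ≫ 0`).  (i) is Fukuda's Nakayama argument with `Z = (Y + pX)/pX` at finite level
(`FukudaGroup.relIndex_commutator_sup_pow_eq_card_quotient`); (ii) — the printed «in particular `μ_p(K/k) = 0`» — is obtained WITHOUT Iwasawa's
structure theory, through the finite shadow of «`μ = 0` iff the `p`-ranks are bounded» (`FukudaGroup.relIndex_mul_card_le_sq`: with ranks
`≤ r ≤ p^{k₀}`, `e_m + e_{m+2} ≤ 2e_{m+1}` for `m ≥ n + k₀ + 1`; a sequence of naturals with non-increasing differences is eventually linear).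

References: [Fukuda1994] T. Fukuda, *Remarks on ℤ_p-extensions of number fields*, Proc. Japan Acad. 70 A (1994), Thm. 1 (2), p. 264;
[Washington1997] §13.3 Lemmas 13.14–13.18, Prop. 13.22, Prop. 13.23; [Lang1990] Ch. 5 §1 Thm. 1.2, Ch. 13 §2.
-/

noncomputable section

open scoped NumberField IsMulCommutative
open NumberField Field Finset

namespace Literature.NumberTheory.IwasawaTheory

open Literature.NumberTheory.EllipticCurves

variable {K : Type} [Field K] [NumberField K] {p : ℕ} [hp : Fact p.Prime]

/-! ## §1 Two readings of the group-theoretic bricks -/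

/-- The top layer in the setting of `FukudaGroupLayers`: `[A : N_tP_t] = #(A/pA)` (`N_t ∩ A = ν_t Y₀ = 0`). [cite: Washington1997, §13.3 Lemma 13.18] -/
private theorem relIndex_top_pow_eq_card_quotient {G : Type*} [Group G] {A : Subgroup G} [A.Normal] [IsMulCommutative A] [Finite G]
    {p : ℕ} [Fact p.Prime] {g : G} {𝓘 : Set (Subgroup G)} {t : ℕ}
    (hgA : Subgroup.zpowers g ⊓ A = ⊥) (hgen : A ⊔ Subgroup.zpowers g = ⊤) (hind : A.index = p ^ t)
    (h𝓘 : ∀ I ∈ 𝓘, I ⊓ A = ⊥ ∧ (I = ⊥ ∨ I ⊔ A = ⊤)) (hg𝓘 : Subgroup.zpowers g ∈ 𝓘)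
    {Gt : Subgroup G} (hAGt : A ≤ Gt) (hGt : Gt.index = p ^ t) :
    ((⁅Gt, Gt⁆ ⊔ ⨆ I ∈ 𝓘, I ⊓ Gt) ⊔ Subgroup.closure ((fun x : G => x ^ p) '' (Gt : Set G))).relIndex Gt =
      Nat.card (Additive A ⧸ (⊤ : Submodule ℤ (Additive A)).map ((p : ℤ) • (1 : Module.End ℤ (Additive A)))) := by
  have h := FukudaGroup.relIndex_commutator_sup_layer_pow_mul_card hgA hgen hind h𝓘 hg𝓘 le_rfl hAGt hGt
  rw [FukudaGroup.map_subOf_commutator_sup_index_eq_bot hgA hgen hind h𝓘 hg𝓘, bot_sup_eq] at h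
  have hcardA : Nat.card A = Nat.card ↥((⊤ : Submodule ℤ (Additive A)).map ((p : ℤ) • (1 : Module.End ℤ (Additive A)))) *
      Nat.card (Additive A ⧸ (⊤ : Submodule ℤ (Additive A)).map ((p : ℤ) • (1 : Module.End ℤ (Additive A)))) :=
    Submodule.card_eq_card_quotient_mul_card ((⊤ : Submodule ℤ (Additive A)).map ((p : ℤ) • (1 : Module.End ℤ (Additive A))))
  rw [hcardA, mul_comm (Nat.card ↥((⊤ : Submodule ℤ (Additive A)).map _))] at h
  exact Nat.eq_of_mul_eq_mul_right Nat.card_pos h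

/-- The growth step of `FukudaRankGrowthSteps` read on exponents: `[G_k : N_k] = p^a`, `[G_{k+1} : N_{k+1}] = p^b`, `#A = p^c` give
`a + c ≤ 2b`. [cite: Fukuda1994, Thm. 1 (2), p. 264] -/
private theorem add_le_two_mul_of_growth {G : Type*} [Group G] {A : Subgroup G} [A.Normal] [IsMulCommutative A] [Finite G]
    {p : ℕ} [Fact p.Prime] {g : G} {𝓘 : Set (Subgroup G)} {t : ℕ}
    (hgA : Subgroup.zpowers g ⊓ A = ⊥) (hgen : A ⊔ Subgroup.zpowers g = ⊤) (hind : A.index = p ^ t)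
    (h𝓘 : ∀ I ∈ 𝓘, I ⊓ A = ⊥ ∧ (I = ⊥ ∨ I ⊔ A = ⊤)) (hg𝓘 : Subgroup.zpowers g ∈ 𝓘)
    (hA : ∃ a : ℕ, Nat.card A = p ^ a) {r k₀ k : ℕ}
    (hr : Nat.card (Additive A ⧸ (⊤ : Submodule ℤ (Additive A)).map ((p : ℤ) • (1 : Module.End ℤ (Additive A)))) ≤ p ^ r)
    (hk₀ : r ≤ p ^ k₀) (hk : k₀ + 1 ≤ k) (ht : t = k + 2)
    {Gk : Subgroup G} (hAGk : A ≤ Gk) (hGk : Gk.index = p ^ k)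
    {Gk1 : Subgroup G} (hAGk1 : A ≤ Gk1) (hGk1 : Gk1.index = p ^ (k + 1)) {a b c : ℕ}
    (hek : (⁅Gk, Gk⁆ ⊔ ⨆ I ∈ 𝓘, I ⊓ Gk).relIndex Gk = p ^ a) (hek1 : (⁅Gk1, Gk1⁆ ⊔ ⨆ I ∈ 𝓘, I ⊓ Gk1).relIndex Gk1 = p ^ b)
    (hc : Nat.card A = p ^ c) : a + c ≤ 2 * b := by
  have h := FukudaGroup.relIndex_mul_card_le_sq hgA hgen hind h𝓘 hg𝓘 hA hr hk₀ hk ht hAGk hGk hAGk1 hGk1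
  rw [hek, hek1, hc, ← pow_add, ← pow_mul] at h
  have h2 := (Nat.pow_le_pow_iff_right (Fact.out : p.Prime).one_lt).mp h
  omega

/-! ## §2 Rank constancy and the growth inequality at top `K_{n+t}` -/

/-- **The two conclusions of Fukuda's Thm. 1 (2) at top `K_{n+t}`** (`t ≥ 1`): (i) `r_{n+1} = r_n ⇒ r_{n+t} = r_n`; (ii) if `t = k + 2`,
`k ≥ k₀ + 1`, `r_{n+t} ≤ r ≤ p^{k₀}` then `e_{n+k} + e_{n+k+2} ≤ 2·e_{n+k+1}` (`e_m = ord_p h(K_m)`, `r_m = rank_p Cl(K_m)`); from the package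
`exists_layer_package` and the bricks of `FukudaRankGrowthSteps`. [cite: Fukuda1994, Thm. 1 (2), p. 264 (proof)]
[cite: Washington1997, §13.3 Lemmas 13.15, 13.18, Prop. 13.22, Prop. 13.23] -/
theorem layer_data (κ : ZpExtension K p) {n₀ n : ℕ} (hκ : TotallyRamifiedFrom κ n₀) (hn : n₀ ≤ n) (t : ℕ) (ht : 1 ≤ t) :
    (classGroupPRank κ (n + 1) = classGroupPRank κ n → classGroupPRank κ (n + t) = classGroupPRank κ n) ∧
    (∀ r k₀ k : ℕ, t = k + 2 → k₀ + 1 ≤ k → classGroupPRank κ (n + t) ≤ r → r ≤ p ^ k₀ →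
      classNumberPExp κ (n + k) + classNumberPExp κ (n + k + 2) ≤ 2 * classNumberPExp κ (n + k + 1)) := by
  classical
  have hp0 : 0 < p := hp.out.pos
  obtain ⟨G, _instG, _instF, A', hA'n, _instC, g, 𝓘, hgA, hgen, hA'index, h𝓘, hg𝓘, hA'card, hlayer⟩ :=
    exists_layer_package κ hκ hn t ht
  have hA'pg : ∃ a : ℕ, Nat.card A' = p ^ a := ⟨_, hA'card⟩
  -- ### conclusions
  refine ⟨fun hrk => ?_, fun r k₀ k htk hk hr hrk₀ => ?_⟩
  · -- (i) the rank step with layers `0`, `1`, `t`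
    obtain ⟨G₀, hAG₀, hG₀, -, hr₀⟩ := hlayer 0 (Nat.zero_le t)
    obtain ⟨G₁, hAG₁, hG₁, -, hr₁⟩ := hlayer 1 ht
    obtain ⟨Gt, hAGt, hGt, -, hrt⟩ := hlayer t le_rfl
    rw [add_zero] at hr₀
    have h01 : ((⁅G₀, G₀⁆ ⊔ ⨆ I ∈ 𝓘, I ⊓ G₀) ⊔ Subgroup.closure ((fun x : G => x ^ p) '' (G₀ : Set _))).relIndex G₀ =
        ((⁅G₁, G₁⁆ ⊔ ⨆ I ∈ 𝓘, I ⊓ G₁) ⊔ Subgroup.closure ((fun x : G => x ^ p) '' (G₁ : Set _))).relIndex G₁ := by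
      rw [hr₀, hr₁, hrk]
    have hRt := FukudaGroup.relIndex_commutator_sup_pow_eq_card_quotient hgA hgen hA'index h𝓘 hg𝓘 ht hAG₀ hG₀ hAG₁ hG₁ h01 le_rfl hAGt hGt
    have hR0 := FukudaGroup.relIndex_commutator_sup_pow_eq_card_quotient hgA hgen hA'index h𝓘 hg𝓘 ht hAG₀ hG₀ hAG₁ hG₁ h01
      (Nat.zero_le t) hAG₀ hG₀
    rw [hrt] at hRt
    rw [hr₀] at hR0
    exact Nat.pow_right_injective hp.out.two_le (hRt.trans hR0.symm)
  · -- (ii) the growth step with layers `k`, `k + 1` (and `t = k + 2`)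
    have hkt : k ≤ t := by omega
    obtain ⟨Gk, hAGk, hGk, hek, -⟩ := hlayer k hkt
    obtain ⟨Gk1, hAGk1, hGk1, hek1, -⟩ := hlayer (k + 1) (by omega)
    obtain ⟨Gt, hAGt, hGt, -, hrt⟩ := hlayer t le_rfl
    have hquot := relIndex_top_pow_eq_card_quotient hgA hgen hA'index h𝓘 hg𝓘 hAGt hGt
    rw [hrt] at hquot
    have hrle : Nat.card (Additive A' ⧸ (⊤ : Submodule ℤ (Additive A')).map ((p : ℤ) • (1 : Module.End ℤ (Additive A')))) ≤ p ^ r := by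
      rw [← hquot]; exact Nat.pow_le_pow_right hp0 hr
    have hA'card' : Nat.card A' = p ^ classNumberPExp κ (n + k + 2) := by rw [hA'card, htk, ← Nat.add_assoc]
    have hG' := add_le_two_mul_of_growth hgA hgen hA'index h𝓘 hg𝓘 hA'pg hrle hrk₀ hk htk hAGk hGk hAGk1 hGk1 hek hek1 hA'card'
    rw [show n + (k + 1) = n + k + 1 by ring] at hG'
    exact hG'


/-! ## §3 The theorem -/

/-- A sequence of naturals whose consecutive differences do not increase from some index on (`f m + f (m+2) ≤ 2 f (m+1)`) is eventually
LINEAR: `f m = l·m + ν` for `m ≫ 0` (the differences form a non-increasing sequence of naturals, hence stabilise). [folklore] -/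
private theorem eventually_linear_of_concave {f : ℕ → ℕ} {m₁ : ℕ} (h : ∀ m, m₁ ≤ m → f m + f (m + 2) ≤ 2 * f (m + 1)) :
    ∃ (l : ℕ) (ν : ℤ) (n₁ : ℕ), ∀ m, n₁ ≤ m → (f m : ℤ) = l * m + ν := by
  -- the differences `d m = f (m+1) - f m` (in `ℤ`) are non-increasing from `m₁` on
  have hdiff : ∀ m, m₁ ≤ m → (f (m + 2) : ℤ) - f (m + 1) ≤ (f (m + 1) : ℤ) - f m := by
    intro m hm
    have := h m hm
    omega
  have hmono : ∀ m m', m₁ ≤ m → m ≤ m' → (f (m' + 1) : ℤ) - f m' ≤ (f (m + 1) : ℤ) - f m := by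
    intro m m' hm hmm'
    induction m', hmm' using Nat.le_induction with
    | base => exact le_rfl
    | succ m' hmm' ih => exact (hdiff m' (hm.trans hmm')).trans ih
  -- the differences are nonnegative from `m₁` on (otherwise `f` would become negative)
  have hnonneg : ∀ m, m₁ ≤ m → (0 : ℤ) ≤ (f (m + 1) : ℤ) - f m := by
    intro m hm
    by_contra hneg
    push Not at hneg
    -- `f (m + s) ≤ f m - s` for all `s`
    have hdec : ∀ s : ℕ, (f (m + s) : ℤ) ≤ f m - s := by
      intro s
      induction s with
      | zero => simp
      | succ s ih =>
        have h1 := hmono m (m + s) hm (Nat.le_add_right m s)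
        rw [show m + (s + 1) = m + s + 1 by ring]
        push_cast
        linarith
    have h1 := hdec (f m + 1)
    have h2 : (0 : ℤ) ≤ f (m + (f m + 1)) := Int.natCast_nonneg _
    push_cast at h1
    linarith
  -- the set of values of the differences has a least element, attained at `m₂ ≥ m₁`
  classical
  let S : Set ℕ := {v | ∃ m, m₁ ≤ m ∧ ((f (m + 1) : ℤ) - f m) = v}
  have hSne : S.Nonempty := ⟨((f (m₁ + 1) : ℤ) - f m₁).toNat, m₁, le_rfl, (Int.toNat_of_nonneg (hnonneg m₁ le_rfl)).symm⟩
  obtain ⟨m₂, hm₂, hv⟩ := Nat.sInf_mem hSne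
  set v := sInf S with hvdef
  have hmin : ∀ m, m₁ ≤ m → (v : ℤ) ≤ (f (m + 1) : ℤ) - f m := by
    intro m hm
    have hmem : ((f (m + 1) : ℤ) - f m).toNat ∈ S := ⟨m, hm, (Int.toNat_of_nonneg (hnonneg m hm)).symm⟩
    have h1 := Nat.sInf_le hmem
    rw [← hvdef] at h1
    have h2 : ((v : ℕ) : ℤ) ≤ (((f (m + 1) : ℤ) - f m).toNat : ℤ) := by exact_mod_cast h1
    rwa [Int.toNat_of_nonneg (hnonneg m hm)] at h2
  -- from `m₂` on the differences are constant `= v`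
  have hconst : ∀ m, m₂ ≤ m → (f (m + 1) : ℤ) - f m = v := fun m hm =>
    le_antisymm (hv ▸ hmono m₂ m hm₂ hm) (hmin m (hm₂.trans hm))
  refine ⟨v, (f m₂ : ℤ) - v * m₂, m₂, fun m hm => ?_⟩
  induction m, hm using Nat.le_induction with
  | base => ring
  | succ m hm ih =>
    have h1 := hconst m hm
    push_cast
    linarith

/-- **Fukuda 1994, Theorem 1 (2)** — PROOF of the named fact `fukuda1994_thm1_classGroupPRank_const_of_succ_eq`: for a `ℤ_p`-extension `κ`
of a number field `K` with Fukuda index `n₀` (`TotallyRamifiedFrom κ n₀`), if `rank_p Cl(K_{n+1}) = rank_p Cl(K_n)` for some `n ≥ n₀` then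
`rank_p Cl(K_m) = rank_p Cl(K_n)` for every `m ≥ n`, AND `μ = 0` in growth form (`ClassicalMuVanishes κ`: `e_m = λm + ν` for `m ≫ 0`).
The rank constancy is `layer_data` (i); the rider: with `r = rank_p Cl(K_n)` and `k₀ = r` (`r ≤ p^r`), `layer_data` (ii) at top `m + 2` gives
`e_m + e_{m+2} ≤ 2e_{m+1}` for all `m ≥ n + r + 1`, and `eventually_linear_of_concave` concludes.
[cite: Fukuda1994, Thm. 1 (2), p. 264] [cite: Washington1997, §13.3 Prop. 13.22, Prop. 13.23 and Lemma 13.18] -/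
theorem fukuda1994_thm1_classGroupPRank_const_of_succ_eq_holds :
    fukuda1994_thm1_classGroupPRank_const_of_succ_eq := by
  intro K _ _ p _ κ n₀ hκ n hn hr
  have hconst : ∀ m, n ≤ m → classGroupPRank κ m = classGroupPRank κ n := by
    intro m hm
    obtain ⟨t, rfl⟩ := Nat.exists_eq_add_of_le hm
    rcases Nat.eq_zero_or_pos t with rfl | ht
    · rfl
    · exact (layer_data κ hκ hn t ht).1 hr
  refine ⟨hconst, ?_⟩
  -- the rider `μ = 0`
  set r := classGroupPRank κ n with hrdef
  have hp : 1 < p := (Fact.out : p.Prime).one_lt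
  have hconc : ∀ m, n + r + 1 ≤ m → classNumberPExp κ m + classNumberPExp κ (m + 2) ≤ 2 * classNumberPExp κ (m + 1) := by
    intro m hm
    obtain ⟨k, rfl⟩ : ∃ k, m = n + k := ⟨m - n, by omega⟩
    have h := (layer_data κ hκ hn (k + 2) (by omega)).2 r r k rfl (by omega)
      (by rw [hconst (n + (k + 2)) (Nat.le_add_right _ _)]) (Nat.lt_pow_self hp).le
    simpa [add_assoc] using h
  obtain ⟨l, ν, n₁, hlin⟩ := eventually_linear_of_concave hconc
  exact ⟨l, ν, n₁, hlin⟩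

/-- Corollary (PROVED, unconditional): two consecutive layers `K_n ⊂ K_{n+1}` (`n ≥ n₀`) whose class groups have the same `p`-rank give `μ = 0`
in growth form — `classicalMuVanishes_of_classGroupPRank_succ_eq` of `ClassicalMuInvariant.lean` with its named-fact hypothesis discharged.
[cite: Fukuda1994, Thm. 1 (2), p. 264] -/
theorem classicalMuVanishes_of_classGroupPRank_succ_eq' {F : Type} [Field F] [NumberField F] {q : ℕ} [Fact q.Prime]
    (κ : ZpExtension F q) {n₀ n : ℕ} (hκ : TotallyRamifiedFrom κ n₀) (hn : n₀ ≤ n)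
    (hr : classGroupPRank κ (n + 1) = classGroupPRank κ n) : ClassicalMuVanishes κ :=
  classicalMuVanishes_of_classGroupPRank_succ_eq fukuda1994_thm1_classGroupPRank_const_of_succ_eq_holds κ hκ hn hr

end Literature.NumberTheory.IwasawaTheory

end
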